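import Mathlib
import HarnessLib
import Summits.Ventures.LatticeQCDFlow.Exactness.LatentShiftProposalBias

/-!
# LatticeQCDFlow / Exactness — THE DIRECTION BIT REPAIRS THE SHIFT: the LIFTED flow sampler that carries a direction `σ`, proposes `T^σ x` with
# the plain importance ratio and FLIPS `σ` on rejection, is exact for `π ⊗ (counting on the two directions)` — for every `q`-preserving bijection `T`

HONEST FRAMING: exact (Metropolis-corrected) sampling algorithms for lattice gauge theory;
figures of merit are autocorrelation/cost numbers at stated couplings and volumes; no
continuum-physics claim.

Venture `LatticeQCDFlow` (cell pub-lqcd), topic `Exactness`, FANOUT row 30 (lean-1 GEN-43, part II: MOVES IN FLOW SPACE; the repair of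
`LatentShiftProposalBias`, where the same move WITHOUT the direction bit is shown biased).  NEW WORK of the cell; no definition is introduced, nothing
is cited as a fact.  Tree inputs: `IMHKernel`, `LatentShiftProposalBias.mul_one_sub_imhAccept`.  Printed counterparts NAMED ONLY: Gustafson's guided
walk (Statist. Comput. 8 (1998)); lifting ∕ non-reversible Metropolis (Diaconis–Holmes–Neal 2000; Turitsyn–Chertkov–Vucelja 2011); on the lattice,
"event-chain"-style directed moves.

## The lifted sampler (general measurable `Ω`; flow law `q`; weight `w > 0`, `π = w·q`; `T : Ω ≃ᵐ Ω` with `q.map T = q`; directions `σ ∈ Bool`,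
## `T^true = T`, `T^false = T⁻¹`)

State `(x, σ) ∈ Ω × Bool`.  From `(x, σ)`: propose `y = T^σ x`; with probability `a(x, y) = min(1, w(y)/w(x))` move to `(y, σ)` (keep going); otherwise
move to `(x, ¬σ)` (reverse).  Def-free: ANY kernel `K` on `Ω × Bool` with
`K((x, σ), C) = a(x, T^σx)·1_C(T^σx, σ) + (1 − a(x, T^σx))·1_C(x, ¬σ)` (hypothesis `hK`).  Extended target `π̂ = π ⊗ count_{Bool}` (each direction
with weight one; its `Ω`-marginal is `2π`).

## Results [all ours]

* `symm_preserves_flow`: `q.map T⁻¹ = q` as well; `liftedShift_apply_univ` ∕ `liftedShift_isMarkovKernel`.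
* `liftedShift_forward_eq`: the accepted flux in direction `σ` after the change of variables `y = T^σ x`:
  `∫ w(x)a(x, T^σx)1_C(T^σx, σ) dq = ∫ min(w(T^{¬σ}y), w(y))·1_C(y, σ) dq`.
* **`liftedShift_bind_apply` ∕ `liftedShift_invariant` (SKEW BALANCE)**: `(π̂K)(C) = π̂(C)` for every measurable `C ⊆ Ω × Bool`, i.e. `π̂` is invariant:
  the accepted arrivals at `(y, σ)` come from `T^{¬σ}y` with flux `min(w(T^{¬σ}y), w(y))`, the rejected arrivals at `(y, σ)` come from `(y, ¬σ)` with flux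
  `w(y) − min(w(y), w(T^{¬σ}y))` — they add up to `w(y)`.  Reading off the configuration of the stationary lifted chain therefore samples `π` exactly
  (`liftedTarget_fst`: `π̂(A × Bool) = 2·π(A)`), although the unlifted shift of `LatentShiftProposalBias` does not.
-/

namespace Summit.Ventures.LatticeQCDFlow.Exactness

open MeasureTheory ProbabilityTheory
open scoped ENNReal

variable {Ω : Type*} [MeasurableSpace Ω] {q : Measure Ω} {w : Ω → ℝ}

/-! ## §1 Bookkeeping: the two directions -/

/-- If `T` preserves `q` then so does `T⁻¹`. [ours, bookkeeping] -/
theorem symm_preserves_flow (T : Ω ≃ᵐ Ω) (hT : q.map T = q) : q.map T.symm = q := by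
  conv_lhs => rw [← hT]
  rw [Measure.map_map T.symm.measurable T.measurable, T.symm_comp_self, Measure.map_id]

/-- The direction-`σ` map `T^σ` (`T` or `T⁻¹`) preserves `q`. [ours, bookkeeping] -/
theorem dir_preserves_flow (T : Ω ≃ᵐ Ω) (hT : q.map T = q) (σ : Bool) :
    q.map ((bif σ then T else T.symm : Ω ≃ᵐ Ω) : Ω → Ω) = q := by
  cases σ
  · exact symm_preserves_flow T hT
  · exact hT

/-- `T^{¬σ} = (T^σ)⁻¹`. [ours, bookkeeping] -/
theorem dir_not_eq_symm (T : Ω ≃ᵐ Ω) (σ : Bool) (x : Ω) : (bif !σ then T else T.symm) x = (bif σ then T else T.symm).symm x := by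
  cases σ
  · simp only [Bool.not_false, cond_true, cond_false, MeasurableEquiv.symm_symm]
  · simp only [Bool.not_true, cond_false, cond_true]

omit [MeasurableSpace Ω] in
/-- `ofReal a + ofReal (1 − a) = 1` for the acceptance probability. [ours, bookkeeping] -/
theorem imhAcceptE_add_ofReal_one_sub (hw0 : ∀ x, 0 < w x) (x y : Ω) :
    imhAcceptE w x y + ENNReal.ofReal (1 - imhAccept w x y) = 1 := by
  rw [imhAcceptE, ← ENNReal.ofReal_add (imhAccept_nonneg hw0 x y) (sub_nonneg.2 (imhAccept_le_one w x y)), add_sub_cancel,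
    ENNReal.ofReal_one]

/-- `K((x, σ), Ω × Bool) = 1`. [ours] -/
theorem liftedShift_apply_univ (hw0 : ∀ x, 0 < w x) (T : Ω ≃ᵐ Ω) (K : Kernel (Ω × Bool) (Ω × Bool))
    (hK : ∀ (z : Ω × Bool) {C : Set (Ω × Bool)}, MeasurableSet C → K z C =
      imhAcceptE w z.1 ((bif z.2 then T else T.symm) z.1) * C.indicator 1 ((bif z.2 then T else T.symm) z.1, z.2) +
        ENNReal.ofReal (1 - imhAccept w z.1 ((bif z.2 then T else T.symm) z.1)) * C.indicator 1 (z.1, !z.2))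
    (z : Ω × Bool) : K z Set.univ = 1 := by
  rw [hK z MeasurableSet.univ]
  simp only [Set.indicator_univ, Pi.one_apply, mul_one]
  exact imhAcceptE_add_ofReal_one_sub hw0 _ _

/-- Hence `K` is Markov. [ours, bookkeeping] -/
theorem liftedShift_isMarkovKernel (hw0 : ∀ x, 0 < w x) (T : Ω ≃ᵐ Ω) (K : Kernel (Ω × Bool) (Ω × Bool))
    (hK : ∀ (z : Ω × Bool) {C : Set (Ω × Bool)}, MeasurableSet C → K z C =
      imhAcceptE w z.1 ((bif z.2 then T else T.symm) z.1) * C.indicator 1 ((bif z.2 then T else T.symm) z.1, z.2) +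
        ENNReal.ofReal (1 - imhAccept w z.1 ((bif z.2 then T else T.symm) z.1)) * C.indicator 1 (z.1, !z.2)) :
    IsMarkovKernel K :=
  ⟨fun z => ⟨liftedShift_apply_univ hw0 T K hK z⟩⟩

/-! ## §2 Integration over the two directions and over `π̂ = π ⊗ count` -/

/-- `∫ g dcount_{Bool} = g(true) + g(false)`. [ours, bookkeeping] -/
theorem lintegral_count_bool (g : Bool → ℝ≥0∞) : ∫⁻ σ, g σ ∂(Measure.count : Measure Bool) = g true + g false := by
  rw [lintegral_fintype, Fintype.sum_bool]
  simp only [Measure.count_singleton, mul_one]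

/-- `π̂(C) = ∫ (1_C(x, true) + 1_C(x, false)) dπ`. [ours, bookkeeping] -/
theorem liftedTarget_apply (π : Measure Ω) [SFinite π] {C : Set (Ω × Bool)} (hC : MeasurableSet C) :
    (π.prod (Measure.count : Measure Bool)) C = ∫⁻ x, (C.indicator 1 (x, true) + C.indicator 1 (x, false)) ∂π := by
  rw [Measure.prod_apply hC]
  refine lintegral_congr fun x => ?_
  rw [← lintegral_indicator_one (measurable_prodMk_left hC), lintegral_count_bool]
  rfl

/-- **THE `Ω`-MARGINAL OF `π̂` IS `2π`**: `π̂(A × Bool) = 2·π(A)`. [ours] -/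
theorem liftedTarget_fst (π : Measure Ω) [SFinite π] (A : Set Ω) :
    (π.prod (Measure.count : Measure Bool)) (A ×ˢ Set.univ) = 2 * π A := by
  rw [Measure.prod_prod, Measure.count_univ]
  simp only [ENat.card_eq_coe_fintype_card, Fintype.card_bool, Nat.cast_ofNat, ENat.toENNReal_ofNat]
  rw [mul_comm]

/-! ## §3 The flux in each direction -/

/-- **THE ACCEPTED FLUX IN DIRECTION `σ`, AFTER THE CHANGE OF VARIABLES `y = T^σ x`**:
`∫ w(x)·a(x, T^σx)·1_C(T^σx, σ) q(dx) = ∫ min(w(T^{¬σ}y), w(y))·1_C(y, σ) q(dy)`. [ours] -/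
theorem liftedShift_forward_eq (hw0 : ∀ x, 0 < w x) (T : Ω ≃ᵐ Ω) (hT : q.map T = q) (σ : Bool) (C : Set (Ω × Bool)) :
    ∫⁻ x, ENNReal.ofReal (w x) * (imhAcceptE w x ((bif σ then T else T.symm) x) *
        C.indicator 1 ((bif σ then T else T.symm) x, σ)) ∂q =
      ∫⁻ y, ENNReal.ofReal (min (w ((bif !σ then T else T.symm) y)) (w y)) * C.indicator 1 (y, σ) ∂q := by
  have hSq : q.map ((bif σ then T else T.symm : Ω ≃ᵐ Ω) : Ω → Ω) = q := dir_preserves_flow T hT σ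
  have hpt : ∀ x, ENNReal.ofReal (w x) * (imhAcceptE w x ((bif σ then T else T.symm) x) *
      C.indicator 1 ((bif σ then T else T.symm) x, σ)) =
      (fun y => ENNReal.ofReal (min (w ((bif σ then T else T.symm).symm y)) (w y)) * C.indicator 1 (y, σ))
        ((bif σ then T else T.symm) x) := fun x => by
    simp only
    rw [← mul_assoc, ofReal_mul_imhAcceptE hw0, (bif σ then T else T.symm).symm_apply_apply]
  simp_rw [hpt]
  rw [← lintegral_map_equiv (fun y => ENNReal.ofReal (min (w ((bif σ then T else T.symm).symm y)) (w y)) * C.indicator 1 (y, σ))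
    (bif σ then T else T.symm) (μ := q), hSq]
  refine lintegral_congr fun y => ?_
  rw [dir_not_eq_symm T σ y]

/-- The rejected flux in direction `σ`: `w(x)(1 − a(x, T^σx))·1_C(x, ¬σ) = (w(x) − min(w x, w(T^σx)))·1_C(x, ¬σ)`. [ours, bookkeeping] -/
theorem liftedShift_reject_eq (hw0 : ∀ x, 0 < w x) (T : Ω ≃ᵐ Ω) (σ : Bool) (C : Set (Ω × Bool)) (x : Ω) :
    ENNReal.ofReal (w x) * (ENNReal.ofReal (1 - imhAccept w x ((bif σ then T else T.symm) x)) * C.indicator 1 (x, !σ)) =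
      ENNReal.ofReal (w x - min (w x) (w ((bif σ then T else T.symm) x))) * C.indicator 1 (x, !σ) := by
  rw [← mul_assoc, ← ENNReal.ofReal_mul (hw0 x).le, mul_one_sub_imhAccept hw0]

/-! ## §4 Skew balance: `π̂` is invariant -/

/-- **`(π̂K)(C)` AS TWO PAIRS OF FLUXES.** [ours] -/
theorem liftedShift_bind_apply (hw : Measurable w) (hw0 : ∀ x, 0 < w x) (T : Ω ≃ᵐ Ω) (hT : q.map T = q)
    (K : Kernel (Ω × Bool) (Ω × Bool))
    (hK : ∀ (z : Ω × Bool) {C : Set (Ω × Bool)}, MeasurableSet C → K z C =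
      imhAcceptE w z.1 ((bif z.2 then T else T.symm) z.1) * C.indicator 1 ((bif z.2 then T else T.symm) z.1, z.2) +
        ENNReal.ofReal (1 - imhAccept w z.1 ((bif z.2 then T else T.symm) z.1)) * C.indicator 1 (z.1, !z.2))
    {C : Set (Ω × Bool)} (hC : MeasurableSet C) :
    (((q.withDensity fun x => ENNReal.ofReal (w x)).prod (Measure.count : Measure Bool)).bind K) C =
      (∫⁻ y, ENNReal.ofReal (min (w (T.symm y)) (w y)) * C.indicator 1 (y, true) ∂q +
        ∫⁻ x, ENNReal.ofReal (w x - min (w x) (w (T x))) * C.indicator 1 (x, false) ∂q) +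
      (∫⁻ y, ENNReal.ofReal (min (w (T y)) (w y)) * C.indicator 1 (y, false) ∂q +
        ∫⁻ x, ENNReal.ofReal (w x - min (w x) (w (T.symm x))) * C.indicator 1 (x, true) ∂q) := by
  have hd : Measurable fun x => ENNReal.ofReal (w x) := hw.ennreal_ofReal
  have hKm : Measurable fun z : Ω × Bool => K z C := Kernel.measurable_coe K hC
  have hKσ : ∀ σ : Bool, Measurable fun x : Ω => K (x, σ) C := fun σ => hKm.comp (measurable_id.prodMk measurable_const)
  rw [Measure.bind_apply hC (Kernel.aemeasurable _), lintegral_prod _ hKm.aemeasurable]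
  simp_rw [lintegral_count_bool]
  rw [lintegral_add_left (hKσ true), lintegral_withDensity_eq_lintegral_mul _ hd (hKσ true),
    lintegral_withDensity_eq_lintegral_mul _ hd (hKσ false)]
  simp only [Pi.mul_apply]
  -- direction `true`
  have ht : ∀ x, ENNReal.ofReal (w x) * K (x, true) C =
      ENNReal.ofReal (w x) * (imhAcceptE w x ((bif true then T else T.symm) x) * C.indicator 1 ((bif true then T else T.symm) x, true)) +
        ENNReal.ofReal (w x - min (w x) (w ((bif true then T else T.symm) x))) * C.indicator 1 (x, !true) := fun x => by
    rw [hK (x, true) hC, mul_add, liftedShift_reject_eq hw0 T true C x]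
  have hf : ∀ x, ENNReal.ofReal (w x) * K (x, false) C =
      ENNReal.ofReal (w x) * (imhAcceptE w x ((bif false then T else T.symm) x) * C.indicator 1 ((bif false then T else T.symm) x, false)) +
        ENNReal.ofReal (w x - min (w x) (w ((bif false then T else T.symm) x))) * C.indicator 1 (x, !false) := fun x => by
    rw [hK (x, false) hC, mul_add, liftedShift_reject_eq hw0 T false C x]
  simp_rw [ht, hf]
  have hm1 : ∀ σ : Bool, Measurable fun x => ENNReal.ofReal (w x) * (imhAcceptE w x ((bif σ then T else T.symm) x) *
      C.indicator 1 ((bif σ then T else T.symm) x, σ)) := fun σ =>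
    hd.mul (((measurable_imhAcceptE hw).comp (measurable_id.prodMk (bif σ then T else T.symm).measurable)).mul
      ((measurable_const.indicator hC).comp (((bif σ then T else T.symm).measurable).prodMk measurable_const)))
  rw [lintegral_add_left (hm1 true), lintegral_add_left (hm1 false), liftedShift_forward_eq hw0 T hT true C,
    liftedShift_forward_eq hw0 T hT false C]
  simp only [Bool.not_true, Bool.not_false, cond_true, cond_false]

/-- **THE LIFTED SHIFT SAMPLER IS EXACT (SKEW BALANCE)**: `(π̂K)(C) = π̂(C)` for every measurable `C`. [ours] -/
theorem liftedShift_bind_apply_eq (hw : Measurable w) (hw0 : ∀ x, 0 < w x) (T : Ω ≃ᵐ Ω) (hT : q.map T = q)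
    (K : Kernel (Ω × Bool) (Ω × Bool))
    (hK : ∀ (z : Ω × Bool) {C : Set (Ω × Bool)}, MeasurableSet C → K z C =
      imhAcceptE w z.1 ((bif z.2 then T else T.symm) z.1) * C.indicator 1 ((bif z.2 then T else T.symm) z.1, z.2) +
        ENNReal.ofReal (1 - imhAccept w z.1 ((bif z.2 then T else T.symm) z.1)) * C.indicator 1 (z.1, !z.2))
    [SFinite q] {C : Set (Ω × Bool)} (hC : MeasurableSet C) :
    (((q.withDensity fun x => ENNReal.ofReal (w x)).prod (Measure.count : Measure Bool)).bind K) C =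
      ((q.withDensity fun x => ENNReal.ofReal (w x)).prod (Measure.count : Measure Bool)) C := by
  have hd : Measurable fun x => ENNReal.ofReal (w x) := hw.ennreal_ofReal
  have hi : ∀ σ : Bool, Measurable fun x : Ω => C.indicator (1 : Ω × Bool → ℝ≥0∞) (x, σ) := fun σ =>
    (measurable_const.indicator hC).comp (measurable_id.prodMk measurable_const)
  have hmin : Measurable fun y => ENNReal.ofReal (min (w (T.symm y)) (w y)) * C.indicator 1 (y, true) :=
    ((hw.comp T.symm.measurable).min hw).ennreal_ofReal.mul (hi true)
  have hmin' : Measurable fun y => ENNReal.ofReal (min (w (T y)) (w y)) * C.indicator 1 (y, false) :=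
    ((hw.comp T.measurable).min hw).ennreal_ofReal.mul (hi false)
  have hsum : Measurable fun x => C.indicator (1 : Ω × Bool → ℝ≥0∞) (x, true) + C.indicator 1 (x, false) := (hi true).add (hi false)
  have hwt : Measurable fun y => ENNReal.ofReal (w y) * C.indicator (1 : Ω × Bool → ℝ≥0∞) (y, true) := hd.mul (hi true)
  have hrej : Measurable fun x => ENNReal.ofReal (w x - min (w x) (w (T x))) * C.indicator (1 : Ω × Bool → ℝ≥0∞) (x, false) :=
    ((hw.sub (hw.min (hw.comp T.measurable))).ennreal_ofReal).mul (hi false)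
  -- the two pairs (accepted into `σ`) + (rejected into `σ`) each add up to `∫ w·1_C(·, σ)`
  have e1 : ∫⁻ y, ENNReal.ofReal (min (w (T.symm y)) (w y)) * C.indicator 1 (y, true) ∂q +
      ∫⁻ x, ENNReal.ofReal (w x - min (w x) (w (T.symm x))) * C.indicator 1 (x, true) ∂q =
      ∫⁻ y, ENNReal.ofReal (w y) * C.indicator 1 (y, true) ∂q := by
    rw [← lintegral_add_left hmin]
    refine lintegral_congr fun y => ?_
    rw [← add_mul, min_comm (w (T.symm y)) (w y),
      ← ENNReal.ofReal_add (le_min (hw0 _).le (hw0 _).le) (sub_nonneg.2 (min_le_left _ _)), add_sub_cancel]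
  have e2 : ∫⁻ x, ENNReal.ofReal (w x - min (w x) (w (T x))) * C.indicator 1 (x, false) ∂q +
      ∫⁻ y, ENNReal.ofReal (min (w (T y)) (w y)) * C.indicator 1 (y, false) ∂q =
      ∫⁻ y, ENNReal.ofReal (w y) * C.indicator 1 (y, false) ∂q := by
    rw [← lintegral_add_left hrej]
    refine lintegral_congr fun y => ?_
    rw [← add_mul, min_comm (w (T y)) (w y), add_comm,
      ← ENNReal.ofReal_add (le_min (hw0 _).le (hw0 _).le) (sub_nonneg.2 (min_le_left _ _)), add_sub_cancel]
  rw [liftedShift_bind_apply hw hw0 T hT K hK hC, liftedTarget_apply _ hC, lintegral_withDensity_eq_lintegral_mul _ hd hsum]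
  simp only [Pi.mul_apply]
  rw [add_comm (∫⁻ y, ENNReal.ofReal (min (w (T y)) (w y)) * C.indicator 1 (y, false) ∂q), add_add_add_comm, e1, e2,
    ← lintegral_add_left hwt]
  refine lintegral_congr fun y => ?_
  rw [mul_add]

/-- **… AS INVARIANCE**: `π̂ = (w·q) ⊗ count_{Bool}` is invariant under the lifted kernel. [ours] -/
theorem liftedShift_invariant (hw : Measurable w) (hw0 : ∀ x, 0 < w x) (T : Ω ≃ᵐ Ω) (hT : q.map T = q)
    (K : Kernel (Ω × Bool) (Ω × Bool))
    (hK : ∀ (z : Ω × Bool) {C : Set (Ω × Bool)}, MeasurableSet C → K z C =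
      imhAcceptE w z.1 ((bif z.2 then T else T.symm) z.1) * C.indicator 1 ((bif z.2 then T else T.symm) z.1, z.2) +
        ENNReal.ofReal (1 - imhAccept w z.1 ((bif z.2 then T else T.symm) z.1)) * C.indicator 1 (z.1, !z.2))
    [SFinite q] :
    Kernel.Invariant K ((q.withDensity fun x => ENNReal.ofReal (w x)).prod (Measure.count : Measure Bool)) := by
  show ((q.withDensity fun x => ENNReal.ofReal (w x)).prod (Measure.count : Measure Bool)).bind K = _
  ext C hC
  exact liftedShift_bind_apply_eq hw hw0 T hT K hK hC

end Summit.Ventures.LatticeQCDFlow.Exactness
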